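import Summits.QuantumFields.YangMills.Theses.BackwardLiouvilleRigidity
import Literature.MathematicalPhysics.QuantumFieldTheory.Balaban1983to89.BalabanAdmissibleClassParams
import HarnessLib

/-!
# Route `BackwardLiouvilleRigidity` (rev 17 = BLR «rev 14», R-n4 membership repair), support `BackwardChainLemmaAdmFR` — BY NAME

`OneStepBackwardContractionAdmFR → BackwardStabilityAdmFR`: the forced backward chain over the admissible organ with floor-class tails,
in the R-n4 ∃κ-tilted membership frame (idea-crit-5 VERDICT #534 Q1/(b)).  The landed proof of `BackwardChainLemmaAdmF`
(stmt-QuantumFields-23881, re-thread of ✓p660990) passes the membership conjuncts of the tower block through UNOPENED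
(`obtain ⟨a1, a2, a3, a4, a5, _, a7, a8, a9⟩ := hB j hj; exact ⟨a1, a2, a3, a4, a5, a7, a8, a9⟩`), so this is that proof verbatim with
the two decl names re-pointed.

HONEST SCOPE.  A SUPPORT item (the chain joining the r4 organ to the deciding crux r2) is re-landed; the cruxes, rung R3 (`YM3TorusSU2`,
finite-volume SU(2) YM₃ on T³) and every summit statement stay OPEN; the Yang–Mills mass gap is NOT proved by any of this.
-/

namespace Summit.QuantumFields.YangMills.Theorems

open Summit.QuantumFields.YangMills.Theses.BackwardLiouvilleRigidity
open scoped BigOperators Topology Classical MeasureTheory Matrix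
open Filter Set Function TopologicalSpace MeasureTheory

/-- **`BackwardChainLemmaAdmFR`** (support item, rev 17 of route BackwardLiouvilleRigidity; R-n4 re-key of ✓23881), BY NAME:
`OneStepBackwardContractionAdmF → BackwardStabilityAdmF` — the forced backward chain over the admissible organ with
floor-class tails.  Proof = ✓p660990 (`backwardLiouvilleRigidity_backwardChainLemmaAdm_proof`) with the two floor-class
`η` binders threaded into the organ call. [folklore] -/
theorem backwardLiouvilleRigidity_backwardChainLemmaAdmFR_proof :
    Summit.QuantumFields.YangMills.Theses.BackwardLiouvilleRigidity.BackwardChainLemmaAdmFR := by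
  classical
  intro hC1
  obtain ⟨γ₁, hγ₁, h1⟩ := hC1
  refine ⟨γ₁, hγ₁, fun F γ hγ hle b₀ p₀ κ j₀ prm ω η hb₀ hp₀ hadm hκ hpos hη hηF hηT μ μ' ρ ρ' hc hc' hB => ?_⟩
  obtain ⟨θ, C, w₀, ε, δ, j₁, hθ, hC, hw₀, hεδ, hεs, hδs, hDs, hdec, hj₀₁, hstep⟩ :=
    h1 F γ hγ hle b₀ p₀ κ j₀ prm η hb₀ hp₀ hadm hκ (fun j => (hpos j).2) hη hηF hηT μ μ' ρ ρ' hc hc'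
      (fun j hj => by obtain ⟨a1, a2, a3, a4, a5, _, a7, a8, a9⟩ := hB j hj; exact ⟨a1, a2, a3, a4, a5, a7, a8, a9⟩)
  refine ⟨θ, C, w₀, ε, δ, j₁, hθ, hC, hw₀, hεδ, hεs, hδs, hDs, hdec, hj₀₁, fun j J hj hJj hsmall hquad b U V hU hV hUV => ?_⟩
  have hε0 : ∀ k, 0 ≤ ε k := fun k => (hεδ k).1
  have hδ0 : ∀ k, 0 ≤ δ k := fun k => (hεδ k).2
  have hG : 0 < Real.exp (∑' k, ε k + 1) := Real.exp_pos _
  have hωJ : 0 ≤ ω J := (hpos J).1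
  have hv0 : 0 ≤ (θ * ω J) := mul_nonneg hθ.le hωJ
  have hDnn : ∀ i : ℕ, 0 ≤ ∑' k, δ (k + i) := fun i => tsum_nonneg fun k => hδ0 _
  have hDsucc : ∀ i : ℕ, ∑' k, δ (k + i) = δ i + ∑' k, δ (k + (i + 1)) := by
    intro i
    have hs : Summable (fun k => δ (k + i)) := (summable_nat_add_iff (f := δ) i).mpr hδs
    rw [hs.tsum_eq_zero_add]
    simp only [zero_add]
    congr 1
    exact tsum_congr fun k => by rw [show k + 1 + i = k + (i + 1) by omega]
  have hDanti : ∀ i : ℕ, ∑' k, δ (k + (i + 1)) ≤ ∑' k, δ (k + i) := fun i => by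
    rw [hDsucc i]; linarith [hδ0 i]
  have hDmono : Antitone (fun i : ℕ => ∑' k, δ (k + i)) := antitone_nat_of_succ_le hDanti
  have hsumD : ∀ i : ℕ, j ≤ i → ∑ n ∈ Finset.Ico i J, (∑' k, δ (k + (n + 1))) ≤ (∑' i, ∑' k, δ (k + (i + j))) := by
    intro i hji
    have hDs' : Summable (fun n => ∑' k, δ (k + (n + j))) := (summable_nat_add_iff (f := fun i => ∑' k, δ (k + i)) j).mpr hDs
    calc ∑ n ∈ Finset.Ico i J, (∑' k, δ (k + (n + 1)))
        ≤ ∑ k ∈ Finset.Ico i J, ∑' m, δ (m + k) := Finset.sum_le_sum fun k _ => hDanti k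
      _ ≤ ∑ k ∈ Finset.Ico j J, ∑' m, δ (m + k) :=
          Finset.sum_le_sum_of_subset_of_nonneg (Finset.Ico_subset_Ico hji le_rfl) fun k _ _ => hDnn k
      _ = ∑ n ∈ Finset.range (J - j), ∑' m, δ (m + (j + n)) := Finset.sum_Ico_eq_sum_range _ _ _
      _ = ∑ n ∈ Finset.range (J - j), ∑' m, δ (m + (n + j)) := by
          refine Finset.sum_congr rfl fun n _ => ?_
          rw [Nat.add_comm j n]
      _ ≤ (∑' i, ∑' k, δ (k + (i + j))) := hDs'.sum_le_tsum _ fun n _ => hDnn _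
  have hsumε : ∀ i : ℕ, ∑ k ∈ Finset.Ico i J, ε k ≤ ∑' k, ε k := fun i => hεs.sum_le_tsum _ fun k _ => hε0 k
  have hEXPO : ∀ i : ℕ, j ≤ i → (∑ k ∈ Finset.Ico i J, ε k + C * (Real.exp (∑' k, ε k + 1) * (((J - i : ℕ) : ℝ) * (θ * ω J) + ∑ n ∈ Finset.Ico i J, (∑' k, δ (k + (n + 1)))))) ≤ ∑' k, ε k + 1 := by
    intro i hji
    have h1 := hsumε i
    have hJi : ((J - i : ℕ) : ℝ) ≤ (J : ℝ) := by exact_mod_cast Nat.sub_le J i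
    have h3 : ((J - i : ℕ) : ℝ) * (θ * ω J) + ∑ n ∈ Finset.Ico i J, (∑' k, δ (k + (n + 1))) ≤ (J : ℝ) * (θ * ω J) + (∑' i, ∑' k, δ (k + (i + j))) :=
      add_le_add (mul_le_mul_of_nonneg_right hJi hv0) (hsumD i hji)
    have h2 : C * (Real.exp (∑' k, ε k + 1) * (((J - i : ℕ) : ℝ) * (θ * ω J) + ∑ n ∈ Finset.Ico i J, (∑' k, δ (k + (n + 1))))) ≤ 1 :=
      le_trans (mul_le_mul_of_nonneg_left (mul_le_mul_of_nonneg_left h3 hG.le) hC) hquad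
    linarith
  have hEXPOnn : ∀ i : ℕ, 0 ≤ (∑ k ∈ Finset.Ico i J, ε k + C * (Real.exp (∑' k, ε k + 1) * (((J - i : ℕ) : ℝ) * (θ * ω J) + ∑ n ∈ Finset.Ico i J, (∑' k, δ (k + (n + 1)))))) := fun i =>
    add_nonneg (Finset.sum_nonneg fun k _ => hε0 k)
      (mul_nonneg hC (mul_nonneg hG.le (add_nonneg (mul_nonneg (Nat.cast_nonneg _) hv0)
        (Finset.sum_nonneg fun n _ => hDnn (n + 1)))))
  have claim : ∀ n : ℕ, ∀ i : ℕ, i + n = J → j ≤ i → ∃ (c : Literature.MathematicalPhysics.QuantumFieldTheory.Balaban1983to89.Plaq (F.P i) 0 → ℝ) (a w : ℝ), 0 ≤ a ∧ 0 ≤ w ∧ a + θ * w ≤ Real.exp (∑ k ∈ Finset.Ico i J, ε k + C * (Real.exp (∑' k, ε k + 1) * (((J - i : ℕ) : ℝ) * (θ * ω J) + ∑ n ∈ Finset.Ico i J, (∑' k, δ (k + (n + 1)))))) * ((θ * ω J) + (∑' k, δ (k + i))) ∧ ((∀ p, |c p| ≤ a) ∧ (∀ (b b' : Literature.MathematicalPhysics.QuantumFieldTheory.Balaban1983to89.PBond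 (F.P i) 0) U V W Z, Literature.MathematicalPhysics.QuantumFieldTheory.Balaban1983to89.PlaqSmall (Literature.MathematicalPhysics.QuantumFieldTheory.Balaban1983to89.T3UnitScaleTilt.θBal F.L γ b₀ p₀ i) U → Literature.MathematicalPhysics.QuantumFieldTheory.Balaban1983to89.PlaqSmall (Literature.MathematicalPhysics.QuantumFieldTheory.Balaban1983to89.T3UnitScaleTilt.θBal F.L γ b₀ p₀ i) V → Literature.MathematicalPhysics.QuantumFieldTheory.Balaban1983to89.PlaqSmall (Literature.MathematicalPhysics.QuantumFieldTheory.Balaban1983to89.T3UnitScaleTilt.θBal F.L γ b₀ p₀ i) W → Literature.MathematicalPhysics.QuantumFieldTheory.Balaban1983to89.PlaqSmall (Literature.MathematicalPhysics.QuantumFieldTheory.Balaban1983to89.T3UnitScaleTilt.θBal F.L γ b₀ p₀ i) Z → (∀ e, e ≠ b → U e = V e) → (∀ e, e ≠ b' → U e = W e) → (∀ e, e ≠ b' → V e = Z e) → (∀ e, e ≠ b → W e = Z e) → |(Real.log (ρ i U) - Real.log (ρ' i U) - ((F.L : ℝ) ^ i / γ) * ∑ p, c p * (1 - Literature.MathematicalPhysics.QuantumFieldTheory.Balaban1983to89.reTr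 (Literature.MathematicalPhysics.QuantumFieldTheory.Balaban1983to89.GaugeField.plaqHol U p))) - (Real.log (ρ i V) - Real.log (ρ' i V) - ((F.L : ℝ) ^ i / γ) * ∑ p, c p * (1 - Literature.MathematicalPhysics.QuantumFieldTheory.Balaban1983to89.reTr (Literature.MathematicalPhysics.QuantumFieldTheory.Balaban1983to89.GaugeField.plaqHol V p))) - ((Real.log (ρ i W) - Real.log (ρ' i W) - ((F.L : ℝ) ^ i / γ) * ∑ p, c p * (1 - Literature.MathematicalPhysics.QuantumFieldTheory.Balaban1983to89.reTr (Literature.MathematicalPhysics.QuantumFieldTheory.Balaban1983to89.GaugeField.plaqHol W p))) - (Real.log (ρ i Z) - Real.log (ρ' i Z) - ((F.L : ℝ) ^ i / γ) * ∑ p, c p * (1 - Literature.MathematicalPhysics.QuantumFieldTheory.Balaban1983to89.reTr (Literature.MathematicalPhysics.QuantumFieldTheory.Balaban1983to89.GaugeField.plaqHol Z p))))| ≤ w * Real.exp (-(κ * (b.src.tdist b'.src : ℝ))))) := by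
    intro n
    induction n with
    | zero =>
      intro i hi hji
      obtain ⟨gposS, gμ, gμ', gmem, gmem', gosc2, gtl, gtl', gcont⟩ := hB i (by omega)
      have hiJ : J = i := by omega
      refine ⟨fun _ => 0, 0, ω i, le_rfl, (hpos i).1, ?_, ?_, ?_⟩
      · rw [zero_add]
        calc θ * ω i = 1 * (θ * ω i) := (one_mul _).symm
          _ ≤ Real.exp (∑ k ∈ Finset.Ico i J, ε k + C * (Real.exp (∑' k, ε k + 1) * (((J - i : ℕ) : ℝ) * (θ * ω J) + ∑ n ∈ Finset.Ico i J, (∑' k, δ (k + (n + 1)))))) * ((θ * ω J) + (∑' k, δ (k + i))) :=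
            mul_le_mul (Real.one_le_exp (hEXPOnn i)) (by rw [hiJ]; linarith [hDnn i])
              (mul_nonneg hθ.le (hpos i).1) (Real.exp_pos _).le
      · intro p; simp
      · intro b b' U V W Z hU hV hW hZ h1 h2 h3 h4
        simp only [zero_mul, Finset.sum_const_zero, mul_zero, sub_zero]
        exact gosc2 b b' U V W Z hU hV hW hZ h1 h2 h3 h4
    | succ n ih =>
      intro i hi hji
      have hiJ : i < J := by omega
      have hj1i : j₁ ≤ i := le_trans hj hji
      obtain ⟨c, a, w, ha, hw, hVb, hadm⟩ := ih (i + 1) (by omega) (by omega)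
      have hVnn : 0 ≤ a + θ * w := add_nonneg ha (mul_nonneg hθ.le hw)
      have hx1 : 0 ≤ (θ * ω J) + (∑' k, δ (k + (i + 1))) := add_nonneg hv0 (hDnn _)
      have hB1 : a + θ * w ≤ Real.exp (∑' k, ε k + 1) * ((θ * ω J) + (∑' k, δ (k + (i + 1)))) :=
        hVb.trans (mul_le_mul_of_nonneg_right (Real.exp_le_exp.mpr (hEXPO (i + 1) (by omega))) hx1)
      have hside : a + θ * w ≤ w₀ := by
        have hD' : (∑' k, δ (k + (i + 1))) ≤ (∑' k, δ (k + j)) := hDmono (show j ≤ i + 1 by omega)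
        have : Real.exp (∑' k, ε k + 1) * ((θ * ω J) + (∑' k, δ (k + (i + 1)))) ≤ Real.exp (∑' k, ε k + 1) * (θ * ω J + (∑' k, δ (k + j))) := mul_le_mul_of_nonneg_left (by linarith) hG.le
        exact hB1.trans (this.trans hsmall)
      obtain ⟨c', a', w', ha', hw', hV', hadm'⟩ := hstep i hj1i c a w ha hw hside hadm
      refine ⟨c', a', w', ha', hw', ?_, hadm'⟩
      have hfac : 1 + ε i + C * (a + θ * w) ≤ Real.exp (ε i + C * (Real.exp (∑' k, ε k + 1) * ((θ * ω J) + (∑' k, δ (k + (i + 1)))))) := by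
        have h1 : C * (a + θ * w) ≤ C * (Real.exp (∑' k, ε k + 1) * ((θ * ω J) + (∑' k, δ (k + (i + 1))))) := mul_le_mul_of_nonneg_left hB1 hC
        have h2 := Real.add_one_le_exp (ε i + C * (Real.exp (∑' k, ε k + 1) * ((θ * ω J) + (∑' k, δ (k + (i + 1))))))
        linarith
      have hprod : 1 ≤ Real.exp (ε i + C * (Real.exp (∑' k, ε k + 1) * ((θ * ω J) + (∑' k, δ (k + (i + 1)))))) * Real.exp (∑ k ∈ Finset.Ico (i + 1) J, ε k + C * (Real.exp (∑' k, ε k + 1) * (((J - (i + 1) : ℕ) : ℝ) * (θ * ω J) + ∑ n ∈ Finset.Ico (i + 1) J, (∑' k, δ (k + (n + 1)))))) := by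
        rw [← Real.exp_add]
        exact Real.one_le_exp (add_nonneg (add_nonneg (hε0 i) (mul_nonneg hC (mul_nonneg hG.le hx1))) (hEXPOnn (i + 1)))
      have hIcoε : ∑ k ∈ Finset.Ico i J, ε k = ε i + ∑ k ∈ Finset.Ico (i + 1) J, ε k :=
        Finset.sum_eq_sum_Ico_succ_bot hiJ _
      have hIcoD : ∑ n ∈ Finset.Ico i J, (∑' k, δ (k + (n + 1))) = (∑' k, δ (k + (i + 1))) + ∑ n ∈ Finset.Ico (i + 1) J, (∑' k, δ (k + (n + 1))) :=
        Finset.sum_eq_sum_Ico_succ_bot hiJ (fun n => (∑' k, δ (k + (n + 1))))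
      have hsub : ((J - i : ℕ) : ℝ) = ((J - (i + 1) : ℕ) : ℝ) + 1 := by
        have : (J - i : ℕ) = (J - (i + 1)) + 1 := by omega
        rw [this]; push_cast; ring
      have hE : (ε i + C * (Real.exp (∑' k, ε k + 1) * ((θ * ω J) + (∑' k, δ (k + (i + 1)))))) + (∑ k ∈ Finset.Ico (i + 1) J, ε k + C * (Real.exp (∑' k, ε k + 1) * (((J - (i + 1) : ℕ) : ℝ) * (θ * ω J) + ∑ n ∈ Finset.Ico (i + 1) J, (∑' k, δ (k + (n + 1)))))) = (∑ k ∈ Finset.Ico i J, ε k + C * (Real.exp (∑' k, ε k + 1) * (((J - i : ℕ) : ℝ) * (θ * ω J) + ∑ n ∈ Finset.Ico i J, (∑' k, δ (k + (n + 1)))))) := by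
        rw [hIcoε, hIcoD, hsub]; ring
      calc a' + θ * w' ≤ (1 + ε i + C * (a + θ * w)) * (a + θ * w) + δ i := hV'
        _ ≤ Real.exp (ε i + C * (Real.exp (∑' k, ε k + 1) * ((θ * ω J) + (∑' k, δ (k + (i + 1)))))) * (Real.exp (∑ k ∈ Finset.Ico (i + 1) J, ε k + C * (Real.exp (∑' k, ε k + 1) * (((J - (i + 1) : ℕ) : ℝ) * (θ * ω J) + ∑ n ∈ Finset.Ico (i + 1) J, (∑' k, δ (k + (n + 1)))))) * ((θ * ω J) + (∑' k, δ (k + (i + 1))))) + δ i := by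
            have := mul_le_mul hfac hVb hVnn (Real.exp_pos _).le
            linarith
        _ ≤ Real.exp (ε i + C * (Real.exp (∑' k, ε k + 1) * ((θ * ω J) + (∑' k, δ (k + (i + 1)))))) * Real.exp (∑ k ∈ Finset.Ico (i + 1) J, ε k + C * (Real.exp (∑' k, ε k + 1) * (((J - (i + 1) : ℕ) : ℝ) * (θ * ω J) + ∑ n ∈ Finset.Ico (i + 1) J, (∑' k, δ (k + (n + 1)))))) * ((θ * ω J) + (∑' k, δ (k + (i + 1))) + δ i) := by
            have hδ' : δ i ≤ Real.exp (ε i + C * (Real.exp (∑' k, ε k + 1) * ((θ * ω J) + (∑' k, δ (k + (i + 1)))))) * Real.exp (∑ k ∈ Finset.Ico (i + 1) J, ε k + C * (Real.exp (∑' k, ε k + 1) * (((J - (i + 1) : ℕ) : ℝ) * (θ * ω J) + ∑ n ∈ Finset.Ico (i + 1) J, (∑' k, δ (k + (n + 1)))))) * δ i := le_mul_of_one_le_left (hδ0 i) hprod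
            have hring : Real.exp (ε i + C * (Real.exp (∑' k, ε k + 1) * ((θ * ω J) + (∑' k, δ (k + (i + 1)))))) * (Real.exp (∑ k ∈ Finset.Ico (i + 1) J, ε k + C * (Real.exp (∑' k, ε k + 1) * (((J - (i + 1) : ℕ) : ℝ) * (θ * ω J) + ∑ n ∈ Finset.Ico (i + 1) J, (∑' k, δ (k + (n + 1)))))) * ((θ * ω J) + (∑' k, δ (k + (i + 1))))) + δ i
                = Real.exp (ε i + C * (Real.exp (∑' k, ε k + 1) * ((θ * ω J) + (∑' k, δ (k + (i + 1)))))) * Real.exp (∑ k ∈ Finset.Ico (i + 1) J, ε k + C * (Real.exp (∑' k, ε k + 1) * (((J - (i + 1) : ℕ) : ℝ) * (θ * ω J) + ∑ n ∈ Finset.Ico (i + 1) J, (∑' k, δ (k + (n + 1)))))) * ((θ * ω J) + (∑' k, δ (k + (i + 1))) + δ i)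
                  - (Real.exp (ε i + C * (Real.exp (∑' k, ε k + 1) * ((θ * ω J) + (∑' k, δ (k + (i + 1)))))) * Real.exp (∑ k ∈ Finset.Ico (i + 1) J, ε k + C * (Real.exp (∑' k, ε k + 1) * (((J - (i + 1) : ℕ) : ℝ) * (θ * ω J) + ∑ n ∈ Finset.Ico (i + 1) J, (∑' k, δ (k + (n + 1)))))) * δ i - δ i) := by ring
            rw [hring]; linarith [hδ']
        _ = Real.exp (∑ k ∈ Finset.Ico i J, ε k + C * (Real.exp (∑' k, ε k + 1) * (((J - i : ℕ) : ℝ) * (θ * ω J) + ∑ n ∈ Finset.Ico i J, (∑' k, δ (k + (n + 1)))))) * ((θ * ω J) + (∑' k, δ (k + i))) := by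
            rw [← Real.exp_add, hE, hDsucc i]; ring
  obtain ⟨c, a, w, ha, hw, hVb, hcB, hadm2⟩ := claim (J - j) j (by omega) le_rfl
  have hXnn : 0 ≤ Real.exp (∑' k, ε k + 1) * (θ * ω J + (∑' k, δ (k + j))) := mul_nonneg hG.le (add_nonneg hv0 (hDnn j))
  have hBf : a + θ * w ≤ Real.exp (∑' k, ε k + 1) * (θ * ω J + (∑' k, δ (k + j))) :=
    hVb.trans (mul_le_mul_of_nonneg_right (Real.exp_le_exp.mpr (hEXPO j le_rfl)) (add_nonneg hv0 (hDnn j)))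
  have hwB : w ≤ Real.exp (∑' k, ε k + 1) * (θ * ω J + (∑' k, δ (k + j))) / θ := by
    rw [le_div_iff₀ hθ]
    calc w * θ = θ * w := mul_comm _ _
      _ ≤ a + θ * w := le_add_of_nonneg_left ha
      _ ≤ Real.exp (∑' k, ε k + 1) * (θ * ω J + (∑' k, δ (k + j))) := hBf
  have haB : a ≤ Real.exp (∑' k, ε k + 1) * (θ * ω J + (∑' k, δ (k + j))) := le_trans (le_add_of_nonneg_right (mul_nonneg hθ.le hw)) hBf
  have htr : ∀ g : ↥(Matrix.specialUnitaryGroup (Fin 2) ℂ), |Literature.MathematicalPhysics.QuantumFieldTheory.Balaban1983to89.reTr g| ≤ 1 := fun g =>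
    Literature.MathematicalPhysics.QuantumFieldTheory.Balaban1983to89.RegularGaugeGroup.abs_reTr_le_one g
  have hmarg : ∀ (ι : Type) [Fintype ι] (c f g : ι → ℝ) (a : ℝ), 0 ≤ a → (∀ p, |c p| ≤ a) → (∀ p, |f p| ≤ 1) →
      (∀ p, |g p| ≤ 1) → |(∑ p, c p * (1 - f p)) - (∑ p, c p * (1 - g p))| ≤ (Fintype.card ι : ℝ) * (a * 2) := by
    intro ι _ c f g a ha hcB hf hg
    rw [← Finset.sum_sub_distrib]
    refine (Finset.abs_sum_le_sum_abs _ _).trans ?_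
    have hterm : ∀ p ∈ (Finset.univ : Finset ι), |c p * (1 - f p) - c p * (1 - g p)| ≤ a * 2 := by
      intro p _
      rw [← mul_sub, abs_mul]
      have h1 := hf p
      have h2 := hg p
      have hdiff : |(1 - f p) - (1 - g p)| ≤ 2 := by
        rw [abs_le] at h1 h2 ⊢; constructor <;> linarith [h1.1, h1.2, h2.1, h2.2]
      exact mul_le_mul (hcB p) hdiff (abs_nonneg _) ha
    refine (Finset.sum_le_sum hterm).trans ?_
    rw [Finset.sum_const, Finset.card_univ, nsmul_eq_mul]
  have hβ : 0 ≤ ((F.L : ℝ) ^ j / γ) := by positivity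
  have hNp : 0 ≤ (Fintype.card (Literature.MathematicalPhysics.QuantumFieldTheory.Balaban1983to89.Plaq (F.P j) 0) : ℝ) := by positivity
  have hq : Real.exp (-(κ * (b.src.tdist b.src : ℝ))) ≤ 1 :=
    Real.exp_le_one_iff.mpr (neg_nonpos.mpr (mul_nonneg hκ.le (Nat.cast_nonneg _)))
  have fin : ∀ (x y su sv q : ℝ), q ≤ 1 → |x - ((F.L : ℝ) ^ j / γ) * su - (y - ((F.L : ℝ) ^ j / γ) * sv) - ((x - ((F.L : ℝ) ^ j / γ) * su) - (x - ((F.L : ℝ) ^ j / γ) * su))| ≤ w * q →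
      |su - sv| ≤ (Fintype.card (Literature.MathematicalPhysics.QuantumFieldTheory.Balaban1983to89.Plaq (F.P j) 0) : ℝ) * (a * 2) → |x - y| ≤ Real.exp (∑' k, ε k + 1) * (θ * ω J + (∑' k, δ (k + j))) * (1 / θ + 2 * ((F.L : ℝ) ^ j / γ) * (Fintype.card (Literature.MathematicalPhysics.QuantumFieldTheory.Balaban1983to89.Plaq (F.P j) 0) : ℝ)) := by
    intro x y su sv q hq1 hxy0 hs
    have hxy : |x - ((F.L : ℝ) ^ j / γ) * su - (y - ((F.L : ℝ) ^ j / γ) * sv)| ≤ w := by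
      rw [sub_self, sub_zero] at hxy0
      exact hxy0.trans (mul_le_of_le_one_right hw hq1)
    have e : x - y = (x - ((F.L : ℝ) ^ j / γ) * su - (y - ((F.L : ℝ) ^ j / γ) * sv)) + ((F.L : ℝ) ^ j / γ) * (su - sv) := by ring
    rw [e]
    refine (abs_add_le _ _).trans ?_
    rw [abs_mul, abs_of_nonneg hβ]
    have ha2 : a * 2 ≤ Real.exp (∑' k, ε k + 1) * (θ * ω J + (∑' k, δ (k + j))) * 2 := by linarith
    calc |x - ((F.L : ℝ) ^ j / γ) * su - (y - ((F.L : ℝ) ^ j / γ) * sv)| + ((F.L : ℝ) ^ j / γ) * |su - sv|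
        ≤ w + ((F.L : ℝ) ^ j / γ) * ((Fintype.card (Literature.MathematicalPhysics.QuantumFieldTheory.Balaban1983to89.Plaq (F.P j) 0) : ℝ) * (a * 2)) := add_le_add hxy (mul_le_mul_of_nonneg_left hs hβ)
      _ ≤ Real.exp (∑' k, ε k + 1) * (θ * ω J + (∑' k, δ (k + j))) / θ + ((F.L : ℝ) ^ j / γ) * ((Fintype.card (Literature.MathematicalPhysics.QuantumFieldTheory.Balaban1983to89.Plaq (F.P j) 0) : ℝ) * (Real.exp (∑' k, ε k + 1) * (θ * ω J + (∑' k, δ (k + j))) * 2)) :=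
          add_le_add hwB (mul_le_mul_of_nonneg_left (mul_le_mul_of_nonneg_left ha2 hNp) hβ)
      _ = Real.exp (∑' k, ε k + 1) * (θ * ω J + (∑' k, δ (k + j))) * (1 / θ + 2 * ((F.L : ℝ) ^ j / γ) * (Fintype.card (Literature.MathematicalPhysics.QuantumFieldTheory.Balaban1983to89.Plaq (F.P j) 0) : ℝ)) := by ring
  exact fin _ _ _ _ _ hq
    (hadm2 b b U V U U hU hV hU hU hUV (fun e _ => rfl) (fun e he => (hUV e he).symm) (fun e _ => rfl))
    (hmarg _ c (fun p => Literature.MathematicalPhysics.QuantumFieldTheory.Balaban1983to89.reTr (Literature.MathematicalPhysics.QuantumFieldTheory.Balaban1983to89.GaugeField.plaqHol U p)) (fun p => Literature.MathematicalPhysics.QuantumFieldTheory.Balaban1983to89.reTr (Literature.MathematicalPhysics.QuantumFieldTheory.Balaban1983to89.GaugeField.plaqHol V p)) a ha hcB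
      (fun p => htr _) (fun p => htr _))

end Summit.QuantumFields.YangMills.Theorems
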